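import Literature.NumberTheory.Rogawski1990.KottwitzSignTwistedPlane
import Literature.NumberTheory.Rogawski1990.KottwitzSignPlaceReadings
import Literature.NumberTheory.Rogawski1990.SingularObstructionIndicator
import Literature.NumberTheory.Rogawski1990.SingularObstructionVanishing
import Literature.NumberTheory.Rogawski1990.SingularLocalConjugacy
import Literature.NumberTheory.Rogawski1990.BlockDetFrame
import Literature.NumberTheory.Rogawski1990.AdelicCartanClassPlacewise
import Literature.NumberTheory.Automorphic.QuadraticAdeleBaseChange
import Literature.NumberTheory.Automorphic.QuadraticLocalNormCompatibility
import HarnessLib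

/-!
# Kottwitz signs, X: the local norm dictionary and the FRAMED FINITE READING of the sign of an adelic conjugate `g (γ₀ ⊗ 1) g⁻¹`
# (Rogawski 1990, §3.8 Prop. 3.8.1 (d) p. 37, §4.1 (4.1.2) pp. 39–40; Kottwitz 1986 §9; O'Meara §63B, 65:2)

Topic `NumberTheory/Rogawski1990`; namespace `Literature.NumberTheory.Rogawski1990`.  THEOREMS ONLY (no definition, no named fact, no instance,
no notation, no `sorry`).  Cell `pub/hodgecm-mathlib`, ENGINE T1 (crux H413 = `stmt-HodgeConjecture-24833`), row O7 «singular semisimple classes»,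
O7 OWNER WORDS #43∕#46 row (d) «THE SIGN WEIGHT READS THE OBSTRUCTION» (FILE 1 = this trilogy `KottwitzSignTwistedFrame` ∕ `…Arch` ∕ `KottwitzSignLocalFlip`;
FILE 2 `KottwitzSignReadsObs` (A-p18) assembles the two flips with ★ `MatchingAdeleG₂.singularObs_eq_quadraticArtinIndicator` and ★
`quadraticArtinIndicator_eq_natCast_ncard`).  HC_CM is proved only modulo the printed citations until rung 0 closes; nothing printed is consumed here.

## The mathematics

`H ∈ M₃(L)` hermitian non-degenerate over the CM field `L` (`σ` = complex conjugation, `L = L⁺(√θ)`, `θ = cmQuadraticGenerator L`), `γ₀ ∈ U(H)(L⁺)`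
rational split-singular non-central with rational diagonal frame `P` (`ᵗ(σP) H P = diag(d₀,d₁,d₂)`, `γ₀ P = P (a·1₂ ⊕ᶠ b·1₁)`, ★ `exists_diagonal_frame`),
`p` an adelic element of its stable class with adelic conjugator `g`.  At a finite place `v` of `L⁺`, `e_v(p_v)` is the sign of `(γ₀)_v` for the
TWISTED form `(H ⊗ 1)_v (x_g)_v` (★ `kottwitzSign_conj_eq_twistGram`), which in the frame is `(diag(d₀,d₁) y₁) ⊕ᶠ (d₂ y₂)` with
`det y₁ = (adelicBlockDet γ₀ a b g)_v` (★ `exists_twistGram_frame_eq_finSum`, ★ `blockDet_lagrangeIdem_eq_det`); over the FIELD `L ⊗ L⁺_v` (`v` non-split)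
★ `kottwitzSign_eq_neg_one_iff_of_frame_finSum` reads `e_v(p_v) = −1 ↔ −(d₀d₁ ⊗ 1)_v (adelicBlockDet)_v` is not a norm `z · (σ ⊗ 1) z`.

* §1 the local norm dictionary: `adeleToLocal_ideleBaseChange` (`(W ⊗ 1)|_v = ι_v W_v`), **`exists_mul_conjLocal_eq_toLocalRing_iff`**
  (`∃ z, z σz = ι_v t ↔ t ∈ quadraticNormSubgroup (L⁺_v) θ`, every finite `v`), `mem_quadraticNormSubgroup_of_smul_ne` (split `v`: everything is a norm),
  `mul_mem_quadraticNormSubgroup_iff` (the local norm-residue character is a character — ★ bimultiplicativity of the Hilbert symbol).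
* §2 **`kottwitzSignLocal_toLocal_eq_neg_one_iff_of_frame`**.

## References
* [Rogawski1990] J. D. Rogawski, *Automorphic Representations of Unitary Groups in Three Variables*, Ann. of Math. Stud. 123 (1990), §3.3 (3.3.1) p. 22;
  §3.8 Prop. 3.8.1 (a)(d) p. 37; §4.1 (4.1.2) pp. 39–40; §8.2 p. 117.
* [Kottwitz1983] R. E. Kottwitz, *Sign changes in harmonic analysis on reductive groups*, Trans. AMS 278 (1983), 289–297.
* [Kottwitz1986] R. E. Kottwitz, *Stable trace formula: elliptic singular terms*, Math. Ann. 275 (1986), §7 Prop. 7.1, §9.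
* [Omeara1963] O. T. O'Meara, *Introduction to Quadratic Forms* (1963), §63B, §65A Example 65:2.
* [CasselsFrohlichANT1967] Cassels–Fröhlich (eds.), *Algebraic Number Theory* (1967), Ch. II §10, Ch. VII Prop. 1.2.
-/

set_option autoImplicit false

noncomputable section

open NumberField NumberField.InfinitePlace IsDedekindDomain Matrix
open scoped MatrixGroups

namespace Literature.NumberTheory.Rogawski1990

open Literature.NumberTheory.Automorphic Literature.NumberTheory.Automorphic.UnitaryGroup
open Literature.NumberTheory.GaloisRepresentations Literature.NumberTheory.QuadraticForms
open Literature.AlgebraicGeometry.ShimuraVarieties (unitaryGroup hermForm)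

/-! ## §1 Letters, block plumbing, and the local norm dictionary -/

section Letters

variable {S : Type*} [CommRing S] {N₁ N₂ : ℕ}

/-- `(A ⊕ᶠ B)(C ⊕ᶠ D) = AC ⊕ᶠ BD`. [folklore] -/
private theorem finSum_mul_finSum₄ (A C : Matrix (Fin N₁) (Fin N₁) S) (B D : Matrix (Fin N₂) (Fin N₂) S) :
    finSum N₁ N₂ A B * finSum N₁ N₂ C D = finSum N₁ N₂ (A * C) (B * D) := by
  simp only [finSum, Matrix.reindex_apply, Matrix.submatrix_mul_equiv, Matrix.fromBlocks_multiply, Matrix.mul_zero, Matrix.zero_mul,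
    add_zero, zero_add]

/-- `det (A ⊕ᶠ B) = det A · det B`. [folklore] -/
private theorem det_finSum₄ (A : Matrix (Fin N₁) (Fin N₁) S) (B : Matrix (Fin N₂) (Fin N₂) S) : (finSum N₁ N₂ A B).det = A.det * B.det := by
  rw [finSum, Matrix.det_reindex_self, Matrix.det_fromBlocks_zero₂₁]

/-- `⊕ᶠ` is injective in the pair of blocks. [folklore] -/
private theorem finSum_injective₄ {A C : Matrix (Fin N₁) (Fin N₁) S} {B D : Matrix (Fin N₂) (Fin N₂) S} (h : finSum N₁ N₂ A B = finSum N₁ N₂ C D) :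
    A = C ∧ B = D := by
  have h' := (Matrix.reindex finSumFinEquiv finSumFinEquiv).injective h
  rw [Matrix.fromBlocks_inj] at h'
  exact ⟨h'.1, h'.2.2.2⟩

/-- `ᵗ(σ(A ⊕ᶠ B)) = ᵗ(σA) ⊕ᶠ ᵗ(σB)`. [folklore] -/
private theorem finSum_conjTranspose₄ (σ : S →+* S) (A : Matrix (Fin N₁) (Fin N₁) S) (B : Matrix (Fin N₂) (Fin N₂) S) :
    ((finSum N₁ N₂ A B).map σ)ᵀ = finSum N₁ N₂ ((A.map σ)ᵀ) ((B.map σ)ᵀ) := by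
  rw [finSum_map]
  simp only [finSum, Matrix.reindex_apply, Matrix.transpose_submatrix, Matrix.fromBlocks_transpose, Matrix.transpose_zero]

end Letters

section Dictionary

variable {L : Type} [Field L] [NumberField L] [IsCMField L]

/-- `πᵥ ∘ (· ⊗ 1)` intertwines `σ` on `L` with `σᵥ` on `L_v`. [folklore] -/
private theorem adeleToLocal_algebraMap_conj₄ (v : HeightOneSpectrum (𝓞 ↥(maximalRealSubfield L))) (r : L) :
    ((UnitaryGroup.adeleToLocal L v).comp (algebraMap L (AdeleRing (𝓞 L) L))) (cmConjRingHom L r) =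
      UnitaryGroup.conjLocal L (IsCMField.complexConj L) v (((UnitaryGroup.adeleToLocal L v).comp (algebraMap L (AdeleRing (𝓞 L) L))) r) := by
  rw [RingHom.comp_apply, RingHom.comp_apply, ← adeleConj_algebraMap, ← UnitaryGroup.conjAdele_complexConj]
  exact UnitaryGroup.adeleToLocal_conj L (IsCMField.complexConj L) v _

/-- `πᵥ` intertwines `σ_𝔸` with `σᵥ`. [folklore] -/
private theorem adeleToLocal_adeleConj₄ (v : HeightOneSpectrum (𝓞 ↥(maximalRealSubfield L))) (x : AdeleRing (𝓞 L) L) :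
    UnitaryGroup.adeleToLocal L v (adeleConj L x) = UnitaryGroup.conjLocal L (IsCMField.complexConj L) v (UnitaryGroup.adeleToLocal L v x) := by
  rw [← UnitaryGroup.conjAdele_complexConj]
  exact UnitaryGroup.adeleToLocal_conj L (IsCMField.complexConj L) v x

/-- `cmConjRingHom` is an involution. [folklore] -/
private theorem cmConjRingHom_cmConjRingHom₄ (x : L) : cmConjRingHom L (cmConjRingHom L x) = x := by
  rw [cmConjRingHom_apply, cmConjRingHom_apply, IsCMField.complexConj_apply_apply]

omit [IsCMField L] in
/-- **`(W ⊗ 1)|_v = ι_v(W_v)`** — the components above `v` of the base change of an idèle of `L⁺` (★ `baseChange_apply_placesOver`).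
[cite: CasselsFrohlichANT1967, Ch. II §10] -/
theorem adeleToLocal_ideleBaseChange (v : HeightOneSpectrum (𝓞 ↥(maximalRealSubfield L)))
    (W : (AdeleRing (𝓞 ↥(maximalRealSubfield L)) ↥(maximalRealSubfield L))ˣ) :
    UnitaryGroup.adeleToLocal L v ((AdeleRing.ideleBaseChange (↥(maximalRealSubfield L)) L W : (AdeleRing (𝓞 L) L)ˣ) : AdeleRing (𝓞 L) L) =
      UnitaryGroup.toLocalRing L v ((W : AdeleRing (𝓞 ↥(maximalRealSubfield L)) ↥(maximalRealSubfield L)).2 v) := by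
  funext w
  rw [UnitaryGroup.adeleToLocal_apply, AdeleRing.coe_ideleBaseChange, AdeleRing.baseChange_snd, UnitaryGroup.toLocalRing_apply]
  exact UnitaryGroup.baseChange_apply_placesOver L _ w

/-- A square root `α` of `θ = cmQuadraticGenerator L` in `L`: `σ α = −α ≠ 0`, `α α = θ`. [folklore] -/
private theorem exists_sqrt_cmQuadraticGenerator :
    ∃ α : L, α ≠ 0 ∧ IsCMField.complexConj L α = -α ∧
      α * α = algebraMap (↥(maximalRealSubfield L)) L (cmQuadraticGenerator L : ↥(maximalRealSubfield L)) := by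
  obtain ⟨α, h0, hc, hsq⟩ := cmQuadraticGenerator_spec L
  exact ⟨α, h0, hc, by rw [← sq]; exact hsq⟩

/-- **THE LOCAL NORM DICTIONARY**: for `t ∈ L⁺_vˣ`, `ι_v t` is a norm `z · (σ ⊗ 1) z` from `L ⊗ L⁺_v` iff `t ∈ quadraticNormSubgroup (L⁺_v) θ`
(`L ⊗ L⁺_v = L⁺_v ⊕ L⁺_v α`, ★ `quadraticLocalEquiv`; `N(a + b α) = a² − θ b²`, ★ `algebraNorm_quadraticLocalEquiv`, ★ `toLocalRing_algebraNorm`).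
Valid at every finite place, split or not. [cite: Omeara1963, §63B, §65A Example 65:2] [cite: CasselsFrohlichANT1967, Ch. II §10] -/
theorem exists_mul_conjLocal_eq_toLocalRing_iff (v : HeightOneSpectrum (𝓞 ↥(maximalRealSubfield L)))
    (t : (v.adicCompletion ↥(maximalRealSubfield L))ˣ) :
    (∃ z : UnitaryGroup.LocalRing L v, z * UnitaryGroup.conjLocal L (IsCMField.complexConj L) v z =
        UnitaryGroup.toLocalRing L v (t : v.adicCompletion ↥(maximalRealSubfield L))) ↔
      t ∈ quadraticNormSubgroup (v.adicCompletion ↥(maximalRealSubfield L))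
        (algebraMap (↥(maximalRealSubfield L)) (v.adicCompletion ↥(maximalRealSubfield L)) (cmQuadraticGenerator L : ↥(maximalRealSubfield L))) := by
  haveI : Algebra.IsQuadraticExtension ↥(maximalRealSubfield L) L := IsCMField.isQuadraticExtension L
  obtain ⟨α, hα0, hcα, hαα⟩ := exists_sqrt_cmQuadraticGenerator (L := L)
  set Ψ := UnitaryGroup.quadraticLocalEquiv L v (IsCMField.complexConj L) hcα hα0 with hΨ
  rw [mem_quadraticNormSubgroup_iff]
  have hcoe : ((cmQuadraticGenerator L : ↥(maximalRealSubfield L)) : v.adicCompletion ↥(maximalRealSubfield L)) =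
      algebraMap (↥(maximalRealSubfield L)) (v.adicCompletion ↥(maximalRealSubfield L)) (cmQuadraticGenerator L : ↥(maximalRealSubfield L)) := rfl
  constructor
  · rintro ⟨z, hz⟩
    obtain ⟨⟨a, b⟩, rfl⟩ := Ψ.surjective z
    refine ⟨a, b, ?_⟩
    have h := UnitaryGroup.toLocalRing_algebraNorm L v (IsCMField.complexConj L) hcα hα0 (Ψ (a, b))
    rw [hz, hΨ, UnitaryGroup.algebraNorm_quadraticLocalEquiv L v (IsCMField.complexConj L) hcα hα0 hαα, hcoe] at h
    have h' := UnitaryGroup.toLocalRing_injective L v h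
    rw [← h']
    ring
  · rintro ⟨a, b, hab⟩
    refine ⟨Ψ (a, b), ?_⟩
    rw [← UnitaryGroup.toLocalRing_algebraNorm L v (IsCMField.complexConj L) hcα hα0 (Ψ (a, b)), hΨ,
      UnitaryGroup.algebraNorm_quadraticLocalEquiv L v (IsCMField.complexConj L) hcα hα0 hαα, ← hab, hcoe]
    congr 1
    ring

/-- **At a SPLIT place every `ι_v t` is a norm** (`z = ε · ι_v t + (1 − ε)` with the idempotent `ε = 1_w`, ★ `exists_conj_mul_self_eq_zero_of_smul_ne`),
so `L⁺_vˣ = quadraticNormSubgroup (L⁺_v) θ` there. [cite: CasselsFrohlichANT1967, Ch. VII Prop. 1.2 (ii)] [cite: Omeara1963, §65A Example 65:2] -/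
theorem mem_quadraticNormSubgroup_of_smul_ne (v : HeightOneSpectrum (𝓞 ↥(maximalRealSubfield L))) (w : UnitaryGroup.PlacesOver L v)
    (hw : IsCMField.complexConj L • w.1 ≠ w.1) (t : (v.adicCompletion ↥(maximalRealSubfield L))ˣ) :
    t ∈ quadraticNormSubgroup (v.adicCompletion ↥(maximalRealSubfield L))
        (algebraMap (↥(maximalRealSubfield L)) (v.adicCompletion ↥(maximalRealSubfield L)) (cmQuadraticGenerator L : ↥(maximalRealSubfield L))) := by
  rw [← exists_mul_conjLocal_eq_toLocalRing_iff]
  obtain ⟨ε, -, hε, hε'⟩ := exists_conj_mul_self_eq_zero_of_smul_ne v w hw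
  set σv := UnitaryGroup.conjLocal L (IsCMField.complexConj L) v with hσv
  set ι := UnitaryGroup.toLocalRing L v (t : v.adicCompletion ↥(maximalRealSubfield L)) with hι
  have hsum : ε + σv ε = 1 := by
    rw [map_sub, map_one] at hε'
    linear_combination -hε' + hε
  refine ⟨ε * ι + (1 - ε), ?_⟩
  have hσι : σv ι = ι := by rw [hι, hσv, UnitaryGroup.conjLocal_toLocalRing]
  rw [map_add, map_mul, map_sub, map_one, hσι]
  linear_combination (ι * ι - 2 * ι + 1) * hε + (ι - 1) * hsum

/-- **The local norm-residue character is a CHARACTER**: for `s, t ∈ L⁺_vˣ`,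
`(s t ∈ N) ↔ ((s ∈ N) ↔ (t ∈ N))`, `N = quadraticNormSubgroup (L⁺_v) θ` (the subgroup has index `≤ 2`: ★ bimultiplicativity of the Hilbert symbol
`(·, θ)_v`, ★ `hilbertSymbol_eq_one_iff_mem_quadraticNormSubgroup`). [cite: Omeara1963, §63B] -/
theorem mul_mem_quadraticNormSubgroup_iff (v : HeightOneSpectrum (𝓞 ↥(maximalRealSubfield L)))
    (s t : (v.adicCompletion ↥(maximalRealSubfield L))ˣ) :
    s * t ∈ quadraticNormSubgroup (v.adicCompletion ↥(maximalRealSubfield L))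
        (algebraMap (↥(maximalRealSubfield L)) (v.adicCompletion ↥(maximalRealSubfield L)) (cmQuadraticGenerator L : ↥(maximalRealSubfield L))) ↔
      (s ∈ quadraticNormSubgroup (v.adicCompletion ↥(maximalRealSubfield L))
          (algebraMap (↥(maximalRealSubfield L)) (v.adicCompletion ↥(maximalRealSubfield L)) (cmQuadraticGenerator L : ↥(maximalRealSubfield L))) ↔
        t ∈ quadraticNormSubgroup (v.adicCompletion ↥(maximalRealSubfield L))
          (algebraMap (↥(maximalRealSubfield L)) (v.adicCompletion ↥(maximalRealSubfield L)) (cmQuadraticGenerator L : ↥(maximalRealSubfield L)))) := by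
  haveI : CharZero (v.adicCompletion ↥(maximalRealSubfield L)) := charZero_of_injective_algebraMap (algebraMap (↥(maximalRealSubfield L)) _).injective
  haveI : NeZero (2 : v.adicCompletion ↥(maximalRealSubfield L)) := ⟨two_ne_zero⟩
  set θv := algebraMap (↥(maximalRealSubfield L)) (v.adicCompletion ↥(maximalRealSubfield L)) (cmQuadraticGenerator L : ↥(maximalRealSubfield L))
    with hθv
  have hθ0 : θv ≠ 0 := by
    rw [hθv, map_ne_zero]
    intro h
    exact not_isSquare_cmQuadraticGenerator L (by rw [h]; exact IsSquare.zero)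
  rw [← hilbertSymbol_eq_one_iff_mem_quadraticNormSubgroup hθ0, ← hilbertSymbol_eq_one_iff_mem_quadraticNormSubgroup hθ0,
    ← hilbertSymbol_eq_one_iff_mem_quadraticNormSubgroup hθ0, Units.val_mul,
    hilbertSymbol_adicCompletion_mul_left (↥(maximalRealSubfield L)) v s.ne_zero t.ne_zero hθ0]
  rcases hilbertSymbol_eq_one_or_eq_neg_one (s : v.adicCompletion ↥(maximalRealSubfield L)) θv with h1 | h1 <;>
    rcases hilbertSymbol_eq_one_or_eq_neg_one (t : v.adicCompletion ↥(maximalRealSubfield L)) θv with h2 | h2 <;>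
    simp [h1, h2]

end Dictionary
/-! ## §2 The framed finite reading for an arbitrary adelic conjugate (non-split `v`) -/

section FiniteFrame

variable {L : Type} [Field L] [NumberField L] [IsCMField L] {H : Matrix (Fin 3) (Fin 3) L} {γ₀ : (UnitaryGroup.cmDatum L 3 H).Rational}

/-- `diag(d) = diag(d₀, d₁) ⊕ᶠ diag(d₂)`. [folklore] -/
private theorem diagonal_eq_finSum {S : Type*} [CommRing S] (d : Fin 3 → S) :
    Matrix.diagonal d = finSum 2 1 (Matrix.diagonal ![d 0, d 1]) (Matrix.diagonal ![d 2]) := by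
  rw [finSum_diagonal_eq_diagonal]
  congr 1
  funext i; fin_cases i <;> rfl

/-- **THE FRAMED FINITE READING at a non-split place `v`**: for `H` hermitian non-degenerate, a rational frame `P` of the split-singular
`γ₀` (`ᵗ(σP) H P = diag(d)`, `γ₀ P = P (a·1₂ ⊕ᶠ b·1₁)`, `a ≠ b`), a matching adèle `p` with adelic conjugator `g`, and a place `v` of `L⁺`
NON-SPLIT in `L`: `e_v(p_v) = −1` iff `−(d₀ d₁ ⊗ 1)_v · (adelicBlockDet γ₀ a b g)_v` is NOT a norm `z · (σ ⊗ 1) z` from `L ⊗ L⁺_v`.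
Route: `e_v(p_v) = e_{(H ⊗ 1)_v}(g_v (γ₀)_v g_v⁻¹) = e_{G′}((γ₀)_v)` with `G′ = ᵗ(σ_v g_v)(H ⊗ 1)_v g_v` (★ `kottwitzSign_conj_eq_twistGram`); in the frame
`ᵗ(σ P_v) G′ P_v = (diag(d₀,d₁) y₁) ⊕ᶠ (d₂ y₂)` (★ `exists_twistGram_frame_eq_finSum`) with `det y₁ = (adelicBlockDet)_v` (★ `blockDet_lagrangeIdem_eq_det`);
★ `kottwitzSign_eq_neg_one_iff_of_frame_finSum` over the FIELD `L ⊗ L⁺_v` (★ `LocalRing.isField_of_smul_eq`).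
[cite: Rogawski1990, §3.8 Prop. 3.8.1 (d) p. 37; §4.1 (4.1.2) pp. 39–40; §3.3 (3.3.1) p. 22] [cite: Kottwitz1986, §9] -/
theorem kottwitzSignLocal_toLocal_eq_neg_one_iff_of_frame (hH : (H.map (cmConjRingHom L))ᵀ = H) (hHd : H.det ≠ 0) {a b : L} (hab : a ≠ b)
    {P : GL (Fin 3) L} {d : Fin 3 → L}
    (hP : (((P : Matrix (Fin 3) (Fin 3) L)).map (cmConjRingHom L))ᵀ * H * (P : Matrix (Fin 3) (Fin 3) L) = Matrix.diagonal d)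
    (hγP : (((γ₀ : unitaryGroup (cmConjRingHom L) H).val : GL (Fin 3) L).val : Matrix (Fin 3) (Fin 3) L) * (P : Matrix (Fin 3) (Fin 3) L) =
      (P : Matrix (Fin 3) (Fin 3) L) * finSum 2 1 (a • (1 : Matrix (Fin 2) (Fin 2) L)) (b • (1 : Matrix (Fin 1) (Fin 1) L)))
    (p : MatchingAdeleG₂ L H H γ₀) {g : GL (Fin 3) (AdeleRing (𝓞 L) L)}
    (hg : g * (((UnitaryGroup.cmDatum L 3 H).toAdelic γ₀).val : GL (Fin 3) (AdeleRing (𝓞 L) L)) * g⁻¹ = (p.adele.val : GL (Fin 3) (AdeleRing (𝓞 L) L)))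
    (v : HeightOneSpectrum (𝓞 ↥(maximalRealSubfield L))) (w : UnitaryGroup.PlacesOver L v) (hw : IsCMField.complexConj L • w.1 = w.1) :
    kottwitzSignLocal L 3 H v (ConjClasses.mk ((UnitaryGroup.cmDatum L 3 H).toLocal v p.adele)) = -1 ↔
      ¬ ∃ z : UnitaryGroup.LocalRing L v, z * UnitaryGroup.conjLocal L (IsCMField.complexConj L) v z =
        -(UnitaryGroup.adeleToLocal L v (algebraMap L (AdeleRing (𝓞 L) L) (d 0 * d 1) * adelicBlockDet γ₀ a b g)) := by
  classical
  -- LETTERS at `v`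
  set 𝔸 := AdeleRing (𝓞 L) L with h𝔸
  set πv := UnitaryGroup.adeleToLocal L v with hπv
  set σv := UnitaryGroup.conjLocal L (IsCMField.complexConj L) v with hσv
  set F : L →+* UnitaryGroup.LocalRing L v := πv.comp (algebraMap L 𝔸) with hFdef
  have hF : ∀ r : L, F (cmConjRingHom L r) = σv (F r) := fun r => adeleToLocal_algebraMap_conj₄ v r
  haveI : Algebra.IsQuadraticExtension ↥(maximalRealSubfield L) L := IsCMField.isQuadraticExtension L
  obtain ⟨α, hα0, hcα, -⟩ := exists_sqrt_cmQuadraticGenerator (L := L)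
  have hσσv : ∀ x, σv (σv x) = x := Liu2021.LemD1OfPlace.conjLocal_conjLocal_apply L v (IsCMField.complexConj L) hcα hα0
  -- names for the mapped objects
  set Hv : Matrix (Fin 3) (Fin 3) (UnitaryGroup.LocalRing L v) := (H.map (algebraMap L 𝔸)).map πv with hHv
  have hHvF : Hv = H.map F := by rw [hHv, Matrix.map_map]; rfl
  set Pv : GL (Fin 3) (UnitaryGroup.LocalRing L v) := Matrix.GeneralLinearGroup.map F P with hPvdef
  have hPv : Pv.val = (P : Matrix (Fin 3) (Fin 3) L).map F := rfl
  set γ𝔸 : GL (Fin 3) 𝔸 := ((UnitaryGroup.cmDatum L 3 H).toAdelic γ₀).val with hγ𝔸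
  have hγ𝔸val : (γ𝔸 : Matrix (Fin 3) (Fin 3) 𝔸) = ((((γ₀ : unitaryGroup (cmConjRingHom L) H).val : GL (Fin 3) L) : Matrix (Fin 3) (Fin 3) L)).map
      (algebraMap L 𝔸) := by
    rw [hγ𝔸, UnitaryGroup.coe_cmDatum_toAdelic, val_toAdeleGL]
  set γv : GL (Fin 3) (UnitaryGroup.LocalRing L v) := Matrix.GeneralLinearGroup.map πv γ𝔸 with hγvdef
  have hγvval : γv.val = (γ𝔸 : Matrix (Fin 3) (Fin 3) 𝔸).map πv := rfl
  have hγvF : γv.val =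
      ((((γ₀ : unitaryGroup (cmConjRingHom L) H).val : GL (Fin 3) L) : Matrix (Fin 3) (Fin 3) L)).map F := by
    rw [hγvval, hγ𝔸val, Matrix.map_map]; rfl
  set gv : GL (Fin 3) (UnitaryGroup.LocalRing L v) := Matrix.GeneralLinearGroup.map πv g with hgvdef
  have hgvval : gv.val = (g : Matrix (Fin 3) (Fin 3) 𝔸).map πv := rfl
  set xg : Matrix (Fin 3) (Fin 3) 𝔸 := (H.map (algebraMap L 𝔸))⁻¹ * twistGram (adeleConj L) (H.map (algebraMap L 𝔸)) (g : Matrix (Fin 3) (Fin 3) 𝔸) with hxg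
  set xv : Matrix (Fin 3) (Fin 3) (UnitaryGroup.LocalRing L v) := xg.map πv with hxvdef
  -- unit determinants
  have hHu : IsUnit H.det := isUnit_iff_ne_zero.mpr hHd
  have hHvd : IsUnit Hv.det := by rw [hHvF, ← RingHom.mapMatrix_apply, ← RingHom.map_det]; exact hHu.map F
  have hFab : IsUnit (F a - F b) := by rw [← map_sub]; exact (IsUnit.mk0 _ (sub_ne_zero.mpr hab)).map F
  -- (0) the local sign is the sign of `(γ₀)_v` for the twisted form `G' = ᵗ(σ_v g_v) H_v g_v`
  set G' : Matrix (Fin 3) (Fin 3) (UnitaryGroup.LocalRing L v) :=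
    twistGram σv Hv gv.val with hG'def
  have hq : (((UnitaryGroup.cmDatum L 3 H).toLocal v p.adele).val : GL (Fin 3) (UnitaryGroup.LocalRing L v)) = gv * γv * gv⁻¹ := by
    rw [UnitaryGroup.coe_cmDatum_toLocal, ← hg, map_mul, map_mul, map_inv]
  have hsign : kottwitzSignLocal L 3 H v (ConjClasses.mk ((UnitaryGroup.cmDatum L 3 H).toLocal v p.adele)) =
      kottwitzSign σv G' γv.val := by
    rw [kottwitzSignLocal_mk, hq, Units.val_mul, Units.val_mul]
    exact kottwitzSign_conj_eq_twistGram σv Hv gv _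
  -- (1) the frame at `v`
  set Ha : Matrix (Fin 2) (Fin 2) L := Matrix.diagonal ![d 0, d 1] with hHa
  set Hb : Matrix (Fin 1) (Fin 1) L := Matrix.diagonal ![d 2] with hHb
  have hP' : (((P : Matrix (Fin 3) (Fin 3) L)).map (cmConjRingHom L))ᵀ * H * (P : Matrix (Fin 3) (Fin 3) L) = finSum 2 1 Ha Hb := by
    rw [hP, diagonal_eq_finSum]
  have hPv_frame : twistGram σv Hv Pv.val = finSum 2 1 (Ha.map F) (Hb.map F) := by
    rw [hHvF, hPv, ← twistGram_map (cmConjRingHom L) H σv F hF, twistGram_def, hP', finSum_map]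
  have hsmul1 : ∀ (n : ℕ) (c : L), (c • (1 : Matrix (Fin n) (Fin n) L)).map F = F c • (1 : Matrix (Fin n) (Fin n) (UnitaryGroup.LocalRing L v)) :=
    fun n c => by rw [Matrix.map_smul' _ _ _ (map_mul F), Matrix.map_one _ (map_zero F) (map_one F)]
  have hγv_frame : γv.val * Pv.val =
      Pv.val *
        finSum 2 1 (F a • (1 : Matrix (Fin 2) (Fin 2) (UnitaryGroup.LocalRing L v))) (F b • (1 : Matrix (Fin 1) (Fin 1) (UnitaryGroup.LocalRing L v))) := by
    rw [hγvF, hPv, ← Matrix.map_mul, hγP, Matrix.map_mul, finSum_map, hsmul1, hsmul1]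
  -- (2) `G'` is hermitian, `x_v = Hv⁻¹ G'` commutes with `(γ₀)_v`
  have hσF : (⇑σv ∘ ⇑F : L → UnitaryGroup.LocalRing L v) = ⇑F ∘ ⇑(cmConjRingHom L) := funext fun r => (hF r).symm
  have hσvHv : (Hv.map σv)ᵀ = Hv := by
    rw [hHvF, Matrix.map_map, hσF, ← Matrix.map_map, ← Matrix.transpose_map, hH]
  have hG' : (G'.map σv)ᵀ = G' := conjTranspose_twistGram σv Hv hσσv hσvHv _
  have hgvd : IsUnit gv.val.det := Matrix.isUnits_det_units gv
  have hG'd : IsUnit G'.det := by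
    rw [hG'def, det_twistGram]; exact ((hgvd.map σv).mul hHvd).mul hgvd
  have hxv_eq : xv = Hv⁻¹ * G' := by
    rw [hxvdef, hxg, hG'def, hHv, hπv, hgvval]; exact map_adeleToLocal_inv_mul_twistGram hHd v _
  have hxv_comm : Hv⁻¹ * G' * γv.val =
      γv.val * (Hv⁻¹ * G') := by
    rw [← hxv_eq, hxvdef, hγvval, ← Matrix.map_mul, ← Matrix.map_mul]
    exact congrArg (fun M : Matrix (Fin 3) (Fin 3) 𝔸 => M.map ⇑πv) (commute_adelicCartan hHu p hg).eq
  obtain ⟨y₁, y₂, hG'P⟩ := exists_twistGram_frame_eq_finSum (N₁ := 2) (N₂ := 1) σv hHvd hFab hPv_frame hγv_frame hxv_comm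
  change Matrix (Fin 2) (Fin 2) (UnitaryGroup.LocalRing L v) at y₁
  change twistGram σv G' Pv.val = finSum 2 1 (Ha.map F * y₁) (Hb.map F * y₂) at hG'P
  -- (3) `x_v` in the frame and the plane-block determinant
  have hPu : IsUnit Pv.val.det := Matrix.isUnits_det_units Pv
  have hxvP : xv * Pv.val = Pv.val * finSum 2 1 y₁ y₂ := by
    have hfu : IsUnit (finSum 2 1 (Ha.map F) (Hb.map F)).det := by
      rw [← hPv_frame, det_twistGram]; exact ((hPu.map σv).mul hHvd).mul hPu
    have h1 : finSum 2 1 (Ha.map F) (Hb.map F) * (Pv.val⁻¹ * xv * Pv.val) = finSum 2 1 (Ha.map F) (Hb.map F) * finSum 2 1 y₁ y₂ := by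
      rw [finSum_mul_finSum₄, ← hG'P, ← hPv_frame, twistGram_def, twistGram_def, hxv_eq]
      simp only [Matrix.mul_assoc]
      rw [Matrix.mul_nonsing_inv_cancel_left _ _ hPu, Matrix.mul_nonsing_inv_cancel_left _ _ hHvd]
    have h2 : Pv.val⁻¹ * xv * Pv.val = finSum 2 1 y₁ y₂ := by
      have h := congrArg (fun M => (finSum 2 1 (Ha.map F) (Hb.map F))⁻¹ * M) h1
      simpa only [← Matrix.mul_assoc, Matrix.nonsing_inv_mul _ hfu, Matrix.one_mul] using h
    rw [← h2, ← Matrix.mul_assoc, ← Matrix.mul_assoc, Matrix.mul_nonsing_inv _ hPu, Matrix.one_mul]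
  have hev : (adelicLagrangeIdem γ₀ a b).map ⇑πv =
      F (a - b)⁻¹ • (γv.val - F b • (1 : Matrix (Fin 3) (Fin 3) (UnitaryGroup.LocalRing L v))) := by
    rw [adelicLagrangeIdem_eq, Matrix.map_smul' _ _ _ (map_mul πv), Matrix.map_sub _ (map_sub πv), Matrix.map_smul' _ _ _ (map_mul πv),
      Matrix.map_one _ (map_zero πv) (map_one πv), hγvval, hγ𝔸]
    rfl
  have hu : F (a - b)⁻¹ * (F a - F b) = 1 := by
    rw [← map_sub, ← map_mul, inv_mul_cancel₀ (sub_ne_zero.2 hab), map_one]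
  have hdet₁ : y₁.det = πv (adelicBlockDet γ₀ a b g) := by
    rw [← blockDet_lagrangeIdem_eq_det (N₁ := 2) (N₂ := 1) (P := Pv) hγv_frame hu hxvP, ← hev, hxvdef, hxg, blockDet_map, ← adelicBlockDet_def]
  have hdetB : (Ha.map F * y₁).det = πv (algebraMap L 𝔸 (d 0 * d 1) * adelicBlockDet γ₀ a b g) := by
    rw [Matrix.det_mul, hdet₁, hHa, Matrix.diagonal_map (map_zero F), Matrix.det_diagonal, map_mul]
    simp only [Fin.prod_univ_two, Matrix.cons_val_zero, Matrix.cons_val_one]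
    rw [← map_mul]
    rfl
  -- (4) the blocks of `ᵗ(σPᵥ) G' Pᵥ`: the plane block is hermitian, the line block is non-zero
  have hTh : ((twistGram σv G' Pv.val).map σv)ᵀ = twistGram σv G' Pv.val := conjTranspose_twistGram σv G' hσσv hG' _
  rw [hG'P, finSum_conjTranspose₄] at hTh
  have hB : ((Ha.map F * y₁).map σv)ᵀ = Ha.map F * y₁ := (finSum_injective₄ hTh).1
  have hTd : IsUnit (twistGram σv G' Pv.val).det := by
    rw [det_twistGram]; exact ((hPu.map σv).mul hG'd).mul hPu
  rw [hG'P, det_finSum₄] at hTd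
  have hC : (Hb.map F * y₂) 0 0 ≠ 0 := by
    rw [← Matrix.det_fin_one (Hb.map F * y₂)]
    exact (isUnit_of_mul_isUnit_right hTd).ne_zero
  -- (5) assemble
  have hHP : ((Pv.val : Matrix (Fin 3) (Fin 3) (UnitaryGroup.LocalRing L v)).map σv)ᵀ * G' * Pv.val = finSum 2 1 (Ha.map F * y₁) (Hb.map F * y₂) := by
    rw [← hG'P, twistGram_def]
  -- `L ⊗ L⁺_v` is a FIELD at the non-split `v`
  have hFd : IsField (UnitaryGroup.LocalRing L v) :=
    UnitaryGroup.LocalRing.isField_of_smul_eq (IsCMField.complexConj L) (IsCMField.complexConj_ne_one L) w hw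
  letI : Field (UnitaryGroup.LocalRing L v) := hFd.toField
  rw [hsign, kottwitzSign_eq_neg_one_iff_of_frame_finSum σv G' Pv hFab hγv_frame hHP hB hC, hdetB]
  simp_rw [mul_comm (σv _) _]
  exact Iff.rfl

end FiniteFrame

end Literature.NumberTheory.Rogawski1990

end
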